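import Summits.QuantumFields.BalabanUV.Beta.D1BFx.RestLegSandwich
import Summits.QuantumFields.BalabanUV.Beta.D1BFx.MinimiserColumnGradient
import Literature.MathematicalPhysics.QuantumFieldTheory.Balaban1983to89.Beta.BalabanStepJetsSucc

/-!
# `BalabanUV.Beta.D1BFx.RestLegSandwichGradient` — road «BF-x» for binder row D1, slot (K), PART 24 letter **L-B′ («THE SANDWICH REST LEG IS SMOOTH: ITS FINE GRADIENT
# GAINS ONE MORE POWER OF `n`»)**: the ff block of the sandwich leg `B := sandP n (Ga n a) (multM n (2a∕n⁸) 2) = ℋ_R ∘ 𝒬 ∘ Ga` (this lineage's «SAND-ENV»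
# `RestLegSandwich.exists_sandP_ff_le`: `|B(x, x′)| ≤ n⁻²·K·e^{−(c∕n)|x − x′|₁}`) obeys
# **`|B(x + e_ρ, x′) − B(x, x′)| ≤ n⁻³·K′·e^{−(c∕n)|x − x′|₁}`** with n-free `K′, c`, for every `m` (`n = m + 1`), modulo [B5, Prop. 1.2] ∧ [B5, (1.126)–(1.127)] BY NAME
# (the SAME two displayed hypotheses as «SAND-ENV»; the extra power is L-h PART 1's UNCONDITIONAL gradient letter on the `ℋ_R` column `= wH^{(n)}`)

HONEST DEPENDENCY (cell records, verbatim): «continuum YM on T⁴ ⇐ BetaPertH ∧ nine spine estimates (0/9 proved); BetaPertH ⇐ (D1) ∧ (D4) ∧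
CAP+tail; G-an2-4 gates asym, D1 and NE2/3/4.»  HONEST FRAMING (cell contract, verbatim): «discharging `BetaPertH` makes Bałaban's UV stability
UNCONDITIONAL — a real constructive-QFT result; it is NOT the continuum limit and NOT the Clay problem.»  THIS MODULE DISCHARGES NOTHING of the
wall: it is VERBATIM the route of «SAND-ENV» (`RestLegSandwich.exists_sandP_ff_le`: `sandP = HRp ∘ (Qp ∘ Gp)`, the ff entry a sum over the coarse columns of (`ℋ_R`
column) × (contour sum of the fine leg, `RestLegContourSum.exists_contourSum_Ga_le`, n³)) with the `ℋ_R` column `HRp (x; n•y₀) = wH^{(n)}(x − n•y₀)`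
(`RWeightedLegPack.NlegRoad_inl_inr_coarse`, mod `h12 ∧ h126`) replaced by its fine DIFFERENCE in `x`, bounded by L-h PART 1 `MinimiserColumnGradient.abs_wH_diff_le`
(`n⁻⁶` instead of `n⁻⁵`, UNCONDITIONAL, constant `MD163` for `MG163`): `n⁻⁶ · n³ = n⁻³`.  [folklore] bookkeeping BY NAME; no `def`, no `def … : Prop`, nothing cited, 0 sorry; the printed
statements enter ONLY as the hypotheses `h12 ∧ h126` of the leg letters, never as facts.  WHAT IT IS: the OWNER d1-p2 g23's PART-24 letter L-B′ (`PART24-SPEC-g23.md` §2: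
«`|∇B| ≤ K′∕n³·e^{−(c∕n)|·|}` for `B = −½(sandP)_tt`»; COMMISSION C-g23-1 journal l.49236) — the «one derivative gain per vertex» currency of the (B,B) ∕ (A,B) rest bubbles
(spec §1), for the smooth leg.  WHAT IT IS NOT: NOT a (1.22) row (R-BB ∕ R-AB are the OWNER's read-outs); NOT the gradient in the RIGHT variable `x′` (that lands on the fine
leg `Ga`'s column under the contour sum — `GluonLegProfileD1`, a different count); 0∕4 row-D1 binders; (K) NOT closed; NOT D1, NOT `BetaPertH`, NOT continuum, NOT Clay.

ABSOLUTE RULE (cell charter, verbatim): «No internally-minted statement may enter as a cited fact. Every hypothesis is either kernel-proved in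
this package or a verbatim quotation of a PUBLISHED theorem with page reference. The manuscript(s) under audit are NOT citable for their own
disputed steps — they are the thing under adjudication; programme-internal (2001/route/tribunal) claims are never citable.»

CONTENT (`n = m + 1`).
* [folklore] `summable_compSlice` (the `y`-slice of `comp A B` is summable for two decaying kernels — `BalabanStepJetsSucc.abs_compTerm_le_dd` + `Summable.of_norm_bounded`),
  `HRp_inl_inr_coarse_eq_wH` (the `ℋ_R` column IS `wH^{(n)}` — `NlegRoad_inl_inr_coarse` read through `NlegK_inl_inr_eq_HRp`, mod `h12 ∧ h126`).
* [mod `h12 ∧ h126`] **`exists_sandP_ff_diff_le`** («SAND-GRAD»: `∃ K′ c, 0 < c ∧ 0 ≤ K′ ∧ ∀ m x x′ κ κ′ ρ, |sandP … (x + e_ρ) x′ (inl κ) (inl κ′) − sandP … x x′ (inl κ) (inl κ′)|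
  ≤ (n³)⁻¹·K′·e^{−(c∕n)|x − x′|₁}`), **`exists_decays_blk_sandP_diff_road`** (the same in block currency: the fine-difference kernel of the tt block `Decays` with constant
  `K′∕n³` at rate `c∕n`, every `m`), **`exists_sandP_ff_diff_le_both`** (the RIGHT variable too: the sandwich is symmetric, `RWeightedLegPack.trK_sandP` (file `RWeightedLegPackSymm`)).
Unit `b2b-balaban-beta-d1-formalise-leaf-01` (gen 29), D1 formalisation swarm LEAF PROVER 01, road «BF-x» («SAND-ENV» lineage, gen 20); COMMISSION C-g23-1; INTENT «L-B′» (journal).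
-/

noncomputable section

open Finset
open scoped BigOperators
open Literature.Probability.LatticeModels (Torus.proj)
open Literature.MathematicalPhysics.QuantumFieldTheory.LatticeForm (quo)
open Literature.MathematicalPhysics.QuantumFieldTheory.Balaban1983to89
open Literature.MathematicalPhysics.QuantumFieldTheory.Balaban1983to89.Beta
open B12Sec2to5 (l1 l1_nonneg)
open AffineAveraging (unitVec)
open ExpKernelCalculus (Site MKer Decays comp Zl Zl_pos tsum_exp_shift summable_exp_shift l1_sub_symm l1_sub_triangle)
open PoissonInterior (supNorm)
open KernelSpecInstance (wH l1_le_l1_quo)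
open OneStepResolventKernel (Fib eq_zsmul_quo_of_proj quo_zsmul proj_zsmul)
open VectorTailsLoc (fam kfam)
open Summit.QuantumFields.BalabanUV.Beta.TameKernelCalculus (Spr decays_of_le)
open Summit.QuantumFields.BalabanUV.Beta.D1BFx.PackedKernelSplit (blk)
open Summit.QuantumFields.BalabanUV.Beta.D1BFx.CoarseGramInverse (multM spr_multM)
open Summit.QuantumFields.BalabanUV.Beta.D1BFx.RWeightedLegPack (Gp Qp Cp HRp sandP NlegK NlegRoad Qp_inr_inl NlegK_inl_inr_eq_HRp zsmul_injective spr_HRp spr_Qp spr_Gp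
  NlegRoad_inl_inr_coarse trK_sandP multM_symm)
open Summit.QuantumFields.BalabanUV.Beta.D1BFx.NlegKHessSplit (HRp_inl_inl)
open Summit.QuantumFields.BalabanUV.Beta.D1BFx.GluonLeg (Ga Ga_symm)
open Summit.QuantumFields.BalabanUV.Beta.TameKernelCalculus (trK trK_apply)
open Summit.QuantumFields.BalabanUV.Beta.D1BFx.GluonLegTails (spr_Ga_of_prop12)
open Summit.QuantumFields.BalabanUV.Beta.D1BFx.RestLegContourSum (comp_Qp_Gp_inr_inl exists_contourSum_Ga_le)
open Summit.QuantumFields.BalabanUV.Beta.D1BFx.FrozenLegTails (nOf MOf hn1)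
open Summit.QuantumFields.BalabanUV.Beta.D1BFx.RestLegSandwich (l1_le_four_mul_supNormP)
open Summit.QuantumFields.BalabanUV.Beta.D1BFx.MinimiserColumnGradient (abs_wH_diff_le)
open Summit.QuantumFields.BalabanUV.Beta.FP.PeriodicTransportSum (quotOf)
open BlochFibreUniqueness (quo_add_zsmul)
open B5Hk163Strip (kappa163 kappa163_pos)
open B5Hk163TorusHolderDecay (MD163)
open B4TorusKernel (periodConst)

namespace Summit.QuantumFields.BalabanUV.Beta.D1BFx.RestLegSandwichGradient

/-! ## §1 Two bricks: the composition slice is summable; the `ℋ_R` column is `wH^{(n)}` -/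

section Bricks

/-- [folklore] **THE `y`-SLICE OF `comp A B` IS SUMMABLE** for two kernels decaying at a common positive rate (`abs_compTerm_le_dd` at `δ′ := 0`). -/
theorem summable_compSlice {D : ℕ} {F : Type*} [Fintype F] {A B : MKer D F} {CA CB δ : ℝ} (hA : Decays A CA δ) (hB : Decays B CB δ) (hδ : 0 < δ)
    (x z : Fin D → ℤ) (a b : F) : Summable fun y : Fin D → ℤ => ∑ f, A x y a f * B y z f b := by
  have hs := (summable_exp_shift (show 0 < δ - 0 by linarith) x).mul_left
    ((Fintype.card F : ℝ) * (CA * CB) * Real.exp (-0 * l1 (x - z)))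
  refine Summable.of_norm_bounded hs fun y => ?_
  rw [Real.norm_eq_abs]
  exact BalabanStepJetsSucc.abs_compTerm_le_dd hA hB le_rfl hδ.le x z a b y

variable (m : ℕ) {a : ℝ} (ha : 0 < a)
include ha

/-- [folklore] **THE `ℋ_R` COLUMN OF THE ROAD's SANDWICH IS `wH^{(n)}`** at the coarse columns (mod [B5, Prop. 1.2] ∧ [B5, (1.126)–(1.127)] BY NAME):
`HRp n (Ga n a) (multM n (2a∕n⁸) 2) x (n•y₀) (inl κ) (inr l) = wH^{(n)} κ l (x − n•y₀)` (`NlegRoad_inl_inr_coarse` through `NlegK_inl_inr_eq_HRp`). -/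
theorem HRp_inl_inr_coarse_eq_wH (h12 : B5.Prop12Printed (fam nOf hn1 MOf a ha)) (h126 : B5.Kernel126_127Printed (kfam nOf MOf))
    (x y₀ : Fin 4 → ℤ) (κ l : Fin 4) :
    HRp (m + 1) (Ga (m + 1) a) (multM (m + 1) (2 * a / ((m + 1 : ℕ) : ℝ) ^ 8) 2) x (((m + 1 : ℕ) : ℤ) • y₀) (Sum.inl κ) (Sum.inr l)
      = wH (N := m + 1) κ l (x - ((m + 1 : ℕ) : ℤ) • y₀) := by
  have h := NlegRoad_inl_inr_coarse m ha h12 h126 x y₀ κ l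
  rw [NlegRoad, NlegK_inl_inr_eq_HRp] at h
  exact h

end Bricks

/-! ## §2 «SAND-GRAD»: the fine difference of the sandwich leg's ff block is `O(n⁻³)` with scale-`n` decay (mod `h12 ∧ h126`) -/

section Sandwich

variable {a : ℝ} (ha : 0 < a)
include ha

/-- [mod `h12 ∧ h126`] **«SAND-GRAD» — THE SANDWICH LEG IS SMOOTH: ITS FINE GRADIENT IN THE LEFT VARIABLE IS `O(n⁻³)`.**  ONE pair `(K′, c)` such that for EVERY `m`
(`n = m + 1`), all fine points `x x′`, colours `κ κ′` and directions `ρ`,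
`|sandP n (Ga n a) (multM n (2a∕n⁸) 2) (x + e_ρ) x′ (inl κ) (inl κ′) − sandP n (Ga n a) (multM n (2a∕n⁸) 2) x x′ (inl κ) (inl κ′)| ≤ (n³)⁻¹·K′·e^{−(c∕n)·|x − x′|₁}`.
PROOF: VERBATIM the route of `RestLegSandwich.exists_sandP_ff_le` — the ff entry's DIFFERENCE is the sum over the coarse columns `n•y₀` of (the DIFFERENCE of the `ℋ_R` column,
`= wH(x + e_ρ − n•y₀) − wH(x − n•y₀)`, `≤ n⁻⁶·C₄′·e^{−κ′‖⌊x∕n⌋ − y₀‖∞}` by L-h PART 1 `abs_wH_diff_le`) × (the contour sum of the fine leg, `≤ n³·KQ·e^{−(δ∕(2n))‖x′ − n•y₀‖∞}`);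
the exponent bookkeeping and the coarse sum `Zl 4 (c₀∕2)` are unchanged. -/
theorem exists_sandP_ff_diff_le (h12 : B5.Prop12Printed (fam nOf hn1 MOf a ha)) (h126 : B5.Kernel126_127Printed (kfam nOf MOf)) :
    ∃ K c : ℝ, 0 < c ∧ 0 ≤ K ∧ ∀ (m : ℕ) (x x' : Fin 4 → ℤ) (κ κ' ρ : Fin 4),
      |sandP (m + 1) (Ga (m + 1) a) (multM (m + 1) (2 * a / ((m + 1 : ℕ) : ℝ) ^ 8) 2) (x + unitVec ρ) x' (Sum.inl κ) (Sum.inl κ')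
        - sandP (m + 1) (Ga (m + 1) a) (multM (m + 1) (2 * a / ((m + 1 : ℕ) : ℝ) ^ 8) 2) x x' (Sum.inl κ) (Sum.inl κ')|
        ≤ ((((m + 1 : ℕ) : ℝ)) ^ 3)⁻¹ * K * Real.exp (-(c / ((m + 1 : ℕ) : ℝ)) * l1 (x - x')) := by
  obtain ⟨KQ, δ, hδ, hKQ, hQ⟩ := exists_contourSum_Ga_le ha h12 h126
  -- the constants of the `ℋ_R` column's GRADIENT (L-h PART 1)
  set κ₁ : ℝ := kappa163 (3 + 1) / (3 + 1) with hκ₁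
  set C₄ : ℝ := MD163 (3 + 1) * periodConst (kappa163 (3 + 1)) 3 with hC₄
  have hκ₁pos : 0 < κ₁ := by rw [hκ₁]; have := kappa163_pos (3 + 1); positivity
  set c₀ : ℝ := min (κ₁ / 4) (δ / 8) with hc₀
  have hc₀pos : 0 < c₀ := lt_min (by positivity) (by positivity)
  have hc₀κ : c₀ ≤ κ₁ / 4 := min_le_left _ _
  have hc₀δ : c₀ ≤ δ / 8 := min_le_right _ _
  -- `C₄ ≥ 0`, read off the gradient letter at one point
  have hC₄nn : 0 ≤ C₄ := by
    have h := abs_wH_diff_le (d := 3) (0 + 1) (Nat.le_add_left 1 0) 0 0 0 0 0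
    have h1 : (0 : ℝ) ≤ ((((0 + 1 : ℕ) : ℝ)) ^ (3 + 3))⁻¹ * (MD163 (3 + 1) * periodConst (kappa163 (3 + 1)) 3) :=
      (mul_nonneg_iff_of_pos_right (Real.exp_pos _)).1 ((abs_nonneg _).trans h)
    simpa using h1
  refine ⟨4 * C₄ * KQ * Real.exp (2 * c₀) * Zl 4 (c₀ / 2), c₀ / 2, half_pos hc₀pos,
    by have := Zl_pos (D := 4) (half_pos hc₀pos); positivity, fun m x x' κ κ' ρ => ?_⟩
  have hn1 : 1 ≤ m + 1 := Nat.le_add_left 1 m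
  have hnpos : (0 : ℝ) < ((m + 1 : ℕ) : ℝ) := by exact_mod_cast Nat.succ_pos m
  have hn0 : ((m + 1 : ℕ) : ℝ) ≠ 0 := hnpos.ne'
  -- abbreviations
  set Gl : MKer 4 (Fin 4) := Ga (m + 1) a with hGl
  set Cm : MKer 4 (Fin 4) := multM (m + 1) (2 * a / ((m + 1 : ℕ) : ℝ) ^ 8) 2 with hCm
  set QG : MKer 4 (Fib 3) := comp (Qp (m + 1)) (Gp Gl) with hQG
  set g : (Fin 4 → ℤ) → ℝ := fun w =>
    ∑ f : Fib 3, (HRp (m + 1) Gl Cm (x + unitVec ρ) w (Sum.inl κ) f - HRp (m + 1) Gl Cm x w (Sum.inl κ) f) * QG w x' f (Sum.inl κ') with hg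
  -- Step 0: both composition slices are summable (two decaying kernels at a common rate)
  have hGa : Spr Gl := by
    obtain ⟨C, δ', hδ', h⟩ := spr_Ga_of_prop12 ha h12 h126 (m + 1)
    exact ⟨C, δ', hδ', h⟩
  have hCmS : Spr Cm := by
    obtain ⟨C, δ', hδ', h⟩ := spr_multM (m + 1) (2 * a / ((m + 1 : ℕ) : ℝ) ^ 8) 2
    exact ⟨C, δ', hδ', h⟩
  have hslice : ∀ X : Fin 4 → ℤ, Summable fun w : Fin 4 → ℤ => ∑ f : Fib 3, HRp (m + 1) Gl Cm X w (Sum.inl κ) f * QG w x' f (Sum.inl κ') := by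
    intro X
    obtain ⟨CH, δH, hδH, hH⟩ := spr_HRp (m + 1) hGa hCmS
    obtain ⟨CQ, δQ, hδQ, hQG'⟩ := ChartConjugationRelative.spr_comp (spr_Qp (m + 1)) (spr_Gp hGa)
    have hmin : 0 < min δH δQ := lt_min hδH hδQ
    exact summable_compSlice (decays_of_le hH (min_le_left _ _)) (decays_of_le hQG' (min_le_right _ _)) hmin X x' (Sum.inl κ) (Sum.inl κ')
  -- Step 1: the difference of the ff entries is `∑' w, g w`
  have e1 : sandP (m + 1) Gl Cm (x + unitVec ρ) x' (Sum.inl κ) (Sum.inl κ') - sandP (m + 1) Gl Cm x x' (Sum.inl κ) (Sum.inl κ') = ∑' w, g w := by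
    show (∑' w, ∑ f : Fib 3, HRp (m + 1) Gl Cm (x + unitVec ρ) w (Sum.inl κ) f * QG w x' f (Sum.inl κ'))
        - (∑' w, ∑ f : Fib 3, HRp (m + 1) Gl Cm x w (Sum.inl κ) f * QG w x' f (Sum.inl κ')) = _
    rw [← (hslice (x + unitVec ρ)).tsum_sub (hslice x)]
    refine tsum_congr fun w => ?_
    rw [hg, ← Finset.sum_sub_distrib]
    exact Finset.sum_congr rfl fun f _ => by ring
  -- Step 2: `g` lives on the sublattice
  have hsupp : Function.support g ⊆ Set.range fun y : Fin 4 → ℤ => (((m + 1 : ℕ) : ℤ)) • y := by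
    intro w hw
    by_cases hpw : Torus.proj (m + 1) w = 0
    · exact ⟨quo (m + 1) w, (eq_zsmul_quo_of_proj (N := m + 1) hpw).symm⟩
    · exfalso
      apply hw
      simp only [hg]
      rw [Fintype.sum_sum_type]
      simp only [HRp_inl_inl, sub_self, zero_mul, Finset.sum_const_zero, zero_add, hQG, comp_Qp_Gp_inr_inl, hpw, if_false, mul_zero]
  have e2 : ∑' w, g w = ∑' y₀ : Fin 4 → ℤ, g ((((m + 1 : ℕ) : ℤ)) • y₀) :=
    (Function.Injective.tsum_eq (zsmul_injective (m + 1)) hsupp).symm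
  -- Step 3: the pointwise majorant at a coarse column
  set K₀ : ℝ := ((((m + 1 : ℕ) : ℝ)) ^ 3)⁻¹ * (4 * C₄ * KQ * Real.exp (2 * c₀))
      * Real.exp (-(c₀ / 2 / ((m + 1 : ℕ) : ℝ)) * l1 (x - x')) with hK₀
  have hK₀nn : 0 ≤ K₀ := by positivity
  have hmaj_pt : ∀ y₀ : Fin 4 → ℤ,
      ‖g ((((m + 1 : ℕ) : ℤ)) • y₀)‖ ≤ K₀ * Real.exp (-(c₀ / 2) * l1 (quotOf (m + 1) x - y₀)) := by
    intro y₀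
    rw [Real.norm_eq_abs, hg]
    -- the ff part of the left factor vanishes; the fm part is the DIFFERENCE of the `ℋ_R` column
    have esplit : (∑ f : Fib 3, (HRp (m + 1) Gl Cm (x + unitVec ρ) ((((m + 1 : ℕ) : ℤ)) • y₀) (Sum.inl κ) f
          - HRp (m + 1) Gl Cm x ((((m + 1 : ℕ) : ℤ)) • y₀) (Sum.inl κ) f) * QG ((((m + 1 : ℕ) : ℤ)) • y₀) x' f (Sum.inl κ'))
        = ∑ m' : Fin 4, (HRp (m + 1) Gl Cm (x + unitVec ρ) ((((m + 1 : ℕ) : ℤ)) • y₀) (Sum.inl κ) (Sum.inr m')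
          - HRp (m + 1) Gl Cm x ((((m + 1 : ℕ) : ℤ)) • y₀) (Sum.inl κ) (Sum.inr m')) * QG ((((m + 1 : ℕ) : ℤ)) • y₀) x' (Sum.inr m') (Sum.inl κ') := by
      rw [Fintype.sum_sum_type]
      simp only [HRp_inl_inl, sub_self, zero_mul, Finset.sum_const_zero, zero_add]
    beta_reduce
    rw [esplit]
    -- the two factors
    have hA : ∀ m' : Fin 4, |HRp (m + 1) Gl Cm (x + unitVec ρ) ((((m + 1 : ℕ) : ℤ)) • y₀) (Sum.inl κ) (Sum.inr m')
          - HRp (m + 1) Gl Cm x ((((m + 1 : ℕ) : ℤ)) • y₀) (Sum.inl κ) (Sum.inr m')|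
        ≤ ((((m + 1 : ℕ) : ℝ)) ^ (3 + 3))⁻¹ * C₄ * Real.exp (-(κ₁ * B4ContourShift.supNorm (quotOf (m + 1) x - y₀))) := by
      intro m'
      have e₁ := HRp_inl_inr_coarse_eq_wH m ha h12 h126 (x + unitVec ρ) y₀ κ m'
      have e₀ := HRp_inl_inr_coarse_eq_wH m ha h12 h126 x y₀ κ m'
      have h := abs_wH_diff_le (d := 3) (m + 1) hn1 κ m' ρ x y₀
      rw [hC₄, hκ₁]
      rw [show HRp (m + 1) Gl Cm (x + unitVec ρ) ((((m + 1 : ℕ) : ℤ)) • y₀) (Sum.inl κ) (Sum.inr m')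
            = wH (N := m + 1) κ m' (x - ((m + 1 : ℕ) : ℤ) • y₀ + unitVec ρ) from by rw [← add_sub_right_comm]; exact e₁,
        show HRp (m + 1) Gl Cm x ((((m + 1 : ℕ) : ℤ)) • y₀) (Sum.inl κ) (Sum.inr m') = wH (N := m + 1) κ m' (x - ((m + 1 : ℕ) : ℤ) • y₀) from e₀]
      refine h.trans (le_of_eq ?_)
      ring
    have hB : ∀ m' : Fin 4, |QG ((((m + 1 : ℕ) : ℤ)) • y₀) x' (Sum.inr m') (Sum.inl κ')|
        ≤ (((m + 1 : ℕ) : ℝ)) ^ 3 * KQ * Real.exp (-(δ / 2 / ((m + 1 : ℕ) : ℝ)) * (supNorm (d := 4) (x' - (((m + 1 : ℕ) : ℤ)) • y₀) : ℝ)) := by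
      intro m'
      rw [hQG, comp_Qp_Gp_inr_inl, if_pos (proj_zsmul (N := m + 1) y₀), quo_zsmul]
      exact hQ (m + 1) x' y₀ m' κ'
    -- the exponent bookkeeping (verbatim «SAND-ENV»)
    set T : ℝ := l1 (quotOf (m + 1) x - y₀) with hT
    set U : ℝ := l1 (x' - (((m + 1 : ℕ) : ℤ)) • y₀) with hU
    have hT0 : 0 ≤ T := l1_nonneg _
    have hU0 : 0 ≤ U := l1_nonneg _
    have hS : T ≤ 4 * B4ContourShift.supNorm (quotOf (m + 1) x - y₀) := by
      have h := T4GaugeActionRatePair.l1_le_mul_supNorm (d := 3) (quotOf (m + 1) x - y₀)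
      have e : ((3 : ℕ) : ℝ) + 1 = 4 := by norm_num
      rw [e] at h
      exact h
    have hP : U ≤ 4 * (supNorm (d := 4) (x' - (((m + 1 : ℕ) : ℤ)) • y₀) : ℝ) := l1_le_four_mul_supNormP _
    have htri : l1 (x - x') ≤ ((m + 1 : ℕ) : ℝ) * T + ((m + 1 : ℕ) : ℝ) * 4 + U := by
      have h1 := l1_sub_triangle x ((((m + 1 : ℕ) : ℤ)) • y₀) x'
      have hq : quo (m + 1) (x - (((m + 1 : ℕ) : ℤ)) • y₀) = quotOf (m + 1) x - y₀ := by
        have h := quo_add_zsmul (N := m + 1) x (-y₀)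
        rw [smul_neg, ← sub_eq_add_neg, ← sub_eq_add_neg] at h
        exact h
      have h2 : l1 (x - (((m + 1 : ℕ) : ℤ)) • y₀) ≤ ((m + 1 : ℕ) : ℝ) * T + ((m + 1 : ℕ) : ℝ) * (3 + 1) := by
        have h := l1_le_l1_quo (N := m + 1) (d := 3) (x - (((m + 1 : ℕ) : ℤ)) • y₀)
        rw [hq] at h
        exact_mod_cast h
      have h3 : l1 ((((m + 1 : ℕ) : ℤ)) • y₀ - x') = U := by rw [hU, l1_sub_symm]
      linarith
    have hexp : Real.exp (-(κ₁ * B4ContourShift.supNorm (quotOf (m + 1) x - y₀)))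
          * Real.exp (-(δ / 2 / ((m + 1 : ℕ) : ℝ)) * (supNorm (d := 4) (x' - (((m + 1 : ℕ) : ℤ)) • y₀) : ℝ))
        ≤ Real.exp (2 * c₀) * Real.exp (-(c₀ / 2 / ((m + 1 : ℕ) : ℝ)) * l1 (x - x')) * Real.exp (-(c₀ / 2) * T) := by
      rw [← Real.exp_add, ← Real.exp_add, ← Real.exp_add]
      apply Real.exp_le_exp.2
      have i1 : c₀ * T ≤ κ₁ * B4ContourShift.supNorm (quotOf (m + 1) x - y₀) := by
        have hS0 : 0 ≤ B4ContourShift.supNorm (quotOf (m + 1) x - y₀) := by linarith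
        have h1 : c₀ * T ≤ c₀ * (4 * B4ContourShift.supNorm (quotOf (m + 1) x - y₀)) := mul_le_mul_of_nonneg_left hS (le_of_lt hc₀pos)
        have h2 : c₀ * 4 ≤ κ₁ := by linarith
        nlinarith
      have i2 : c₀ / ((m + 1 : ℕ) : ℝ) * U
          ≤ δ / 2 / ((m + 1 : ℕ) : ℝ) * (supNorm (d := 4) (x' - (((m + 1 : ℕ) : ℤ)) • y₀) : ℝ) := by
        rw [div_mul_eq_mul_div, div_mul_eq_mul_div, div_le_div_iff_of_pos_right hnpos]
        have := mul_le_mul_of_nonneg_left hP (le_of_lt hc₀pos)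
        nlinarith [show (0:ℝ) ≤ (supNorm (d := 4) (x' - (((m + 1 : ℕ) : ℤ)) • y₀) : ℝ) from by positivity]
      have i3 : c₀ / 2 / ((m + 1 : ℕ) : ℝ) * l1 (x - x') ≤ c₀ / 2 * T + 2 * c₀ + c₀ / 2 / ((m + 1 : ℕ) : ℝ) * U := by
        have h := mul_le_mul_of_nonneg_left htri (show 0 ≤ c₀ / 2 / ((m + 1 : ℕ) : ℝ) by positivity)
        have e : c₀ / 2 / ((m + 1 : ℕ) : ℝ) * (((m + 1 : ℕ) : ℝ) * T + ((m + 1 : ℕ) : ℝ) * 4 + U)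
            = c₀ / 2 * T + 2 * c₀ + c₀ / 2 / ((m + 1 : ℕ) : ℝ) * U := by field_simp; ring
        linarith
      have i4 : c₀ / 2 / ((m + 1 : ℕ) : ℝ) * U ≤ c₀ / ((m + 1 : ℕ) : ℝ) * U := by
        have : c₀ / 2 / ((m + 1 : ℕ) : ℝ) ≤ c₀ / ((m + 1 : ℕ) : ℝ) := by
          rw [div_div, div_le_div_iff_of_pos_left hc₀pos (by positivity) hnpos]; linarith
        exact mul_le_mul_of_nonneg_right this hU0
      nlinarith
    -- assemble: `n⁻⁶ · n³ = n⁻³`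
    have hn6 : ((((m + 1 : ℕ) : ℝ)) ^ (3 + 3))⁻¹ * (((m + 1 : ℕ) : ℝ)) ^ 3 = ((((m + 1 : ℕ) : ℝ)) ^ 3)⁻¹ := by
      field_simp
    calc |∑ m' : Fin 4, (HRp (m + 1) Gl Cm (x + unitVec ρ) ((((m + 1 : ℕ) : ℤ)) • y₀) (Sum.inl κ) (Sum.inr m')
              - HRp (m + 1) Gl Cm x ((((m + 1 : ℕ) : ℤ)) • y₀) (Sum.inl κ) (Sum.inr m'))
            * QG ((((m + 1 : ℕ) : ℤ)) • y₀) x' (Sum.inr m') (Sum.inl κ')|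
        ≤ ∑ m' : Fin 4, |HRp (m + 1) Gl Cm (x + unitVec ρ) ((((m + 1 : ℕ) : ℤ)) • y₀) (Sum.inl κ) (Sum.inr m')
              - HRp (m + 1) Gl Cm x ((((m + 1 : ℕ) : ℤ)) • y₀) (Sum.inl κ) (Sum.inr m')|
            * |QG ((((m + 1 : ℕ) : ℤ)) • y₀) x' (Sum.inr m') (Sum.inl κ')| := by
          refine (Finset.abs_sum_le_sum_abs _ _).trans (le_of_eq (Finset.sum_congr rfl fun m' _ => abs_mul _ _))
      _ ≤ ∑ _m' : Fin 4, (((((m + 1 : ℕ) : ℝ)) ^ (3 + 3))⁻¹ * C₄ * Real.exp (-(κ₁ * B4ContourShift.supNorm (quotOf (m + 1) x - y₀))))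
            * ((((m + 1 : ℕ) : ℝ)) ^ 3 * KQ * Real.exp (-(δ / 2 / ((m + 1 : ℕ) : ℝ)) * (supNorm (d := 4) (x' - (((m + 1 : ℕ) : ℤ)) • y₀) : ℝ))) :=
          Finset.sum_le_sum fun m' _ => mul_le_mul (hA m') (hB m') (abs_nonneg _) (by positivity)
      _ = 4 * (((((m + 1 : ℕ) : ℝ) ^ (3 + 3))⁻¹ * ((m + 1 : ℕ) : ℝ) ^ 3) * (C₄ * KQ)) * (Real.exp (-(κ₁ * B4ContourShift.supNorm (quotOf (m + 1) x - y₀))) * Real.exp (-(δ / 2 / ((m + 1 : ℕ) : ℝ)) * (supNorm (d := 4) (x' - ((m + 1 : ℕ) : ℤ) • y₀) : ℝ))) := by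
          rw [Finset.sum_const, Finset.card_univ, Fintype.card_fin, nsmul_eq_mul]; push_cast; ring
      _ ≤ 4 * (((((m + 1 : ℕ) : ℝ) ^ (3 + 3))⁻¹ * ((m + 1 : ℕ) : ℝ) ^ 3) * (C₄ * KQ)) * (Real.exp (2 * c₀) * Real.exp (-(c₀ / 2 / ((m + 1 : ℕ) : ℝ)) * l1 (x - x')) * Real.exp (-(c₀ / 2) * T)) :=
          mul_le_mul_of_nonneg_left hexp (by positivity)
      _ = K₀ * Real.exp (-(c₀ / 2) * T) := by rw [hK₀, ← hn6]; ring
  -- Step 4: sum the majorant over the coarse columns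
  have hsum : Summable fun y₀ : Fin 4 → ℤ => K₀ * Real.exp (-(c₀ / 2) * l1 (quotOf (m + 1) x - y₀)) :=
    (summable_exp_shift (half_pos hc₀pos) (quotOf (m + 1) x)).mul_left K₀
  have hb := tsum_of_norm_bounded hsum.hasSum hmaj_pt
  rw [Real.norm_eq_abs] at hb
  rw [hGl, hCm] at e1
  rw [e1, e2]
  refine hb.trans (le_of_eq ?_)
  rw [tsum_mul_left, tsum_exp_shift, hK₀]
  ring

/-- [mod `h12 ∧ h126`] **«SAND-GRAD» IN BLOCK CURRENCY**: n-free `K′, c > 0` with, for every `m` (`n = m + 1`) and every direction `ρ`,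
`Decays (fun x x′ κ κ′ ↦ blk (sandP …) true true (x + e_ρ) x′ κ κ′ − blk (sandP …) true true x x′ κ κ′) (K′∕n³) (c∕n)` — the `∇B` letter of PART24-SPEC §1 for the (B,B) ∕ (A,B)
bubbles, one power above «SAND-ENV»'s `K∕n²` (the `(−½)•` of the road's `B := −½(sandP)_tt` scales `K′` by `½`). -/
theorem exists_decays_blk_sandP_diff_road (h12 : B5.Prop12Printed (fam nOf hn1 MOf a ha)) (h126 : B5.Kernel126_127Printed (kfam nOf MOf)) :
    ∃ K c : ℝ, 0 < c ∧ 0 ≤ K ∧ ∀ (m : ℕ) (ρ : Fin 4),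
      Decays (fun x x' κ κ' => blk (sandP (m + 1) (Ga (m + 1) a) (multM (m + 1) (2 * a / ((m + 1 : ℕ) : ℝ) ^ 8) 2)) true true (x + unitVec ρ) x' κ κ'
          - blk (sandP (m + 1) (Ga (m + 1) a) (multM (m + 1) (2 * a / ((m + 1 : ℕ) : ℝ) ^ 8) 2)) true true x x' κ κ')
        (K / (((m + 1 : ℕ) : ℝ)) ^ 3) (c / ((m + 1 : ℕ) : ℝ)) := by
  obtain ⟨K, c, hc, hK, h⟩ := exists_sandP_ff_diff_le ha h12 h126
  refine ⟨K, c, hc, hK, fun m ρ x x' κ κ' => ?_⟩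
  show |sandP (m + 1) (Ga (m + 1) a) (multM (m + 1) (2 * a / ((m + 1 : ℕ) : ℝ) ^ 8) 2) (x + unitVec ρ) x' (Sum.inl κ) (Sum.inl κ')
      - sandP (m + 1) (Ga (m + 1) a) (multM (m + 1) (2 * a / ((m + 1 : ℕ) : ℝ) ^ 8) 2) x x' (Sum.inl κ) (Sum.inl κ')| ≤ _
  refine (h m x x' κ κ' ρ).trans (le_of_eq ?_)
  rw [div_eq_mul_inv K]
  ring

/-- [mod `h12 ∧ h126`] **«SAND-GRAD» IN THE RIGHT VARIABLE** — the sandwich is SYMMETRIC (`RWeightedLegPack.trK_sandP` (file `RWeightedLegPackSymm`): `Ga` symmetric by `GluonLeg.Ga_symm`, `multM` by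
`multM_symm`), so the same pair `(K′, c)` bounds `|sandP … x (x′ + e_ρ) (inl κ) (inl κ′) − sandP … x x′ (inl κ) (inl κ′)| ≤ (n³)⁻¹·K′·e^{−(c∕n)|x − x′|₁}` as well. -/
theorem exists_sandP_ff_diff_le_both (h12 : B5.Prop12Printed (fam nOf hn1 MOf a ha)) (h126 : B5.Kernel126_127Printed (kfam nOf MOf)) :
    ∃ K c : ℝ, 0 < c ∧ 0 ≤ K ∧ ∀ (m : ℕ) (x x' : Fin 4 → ℤ) (κ κ' ρ : Fin 4),
      |sandP (m + 1) (Ga (m + 1) a) (multM (m + 1) (2 * a / ((m + 1 : ℕ) : ℝ) ^ 8) 2) (x + unitVec ρ) x' (Sum.inl κ) (Sum.inl κ')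
        - sandP (m + 1) (Ga (m + 1) a) (multM (m + 1) (2 * a / ((m + 1 : ℕ) : ℝ) ^ 8) 2) x x' (Sum.inl κ) (Sum.inl κ')|
        ≤ ((((m + 1 : ℕ) : ℝ)) ^ 3)⁻¹ * K * Real.exp (-(c / ((m + 1 : ℕ) : ℝ)) * l1 (x - x')) ∧
      |sandP (m + 1) (Ga (m + 1) a) (multM (m + 1) (2 * a / ((m + 1 : ℕ) : ℝ) ^ 8) 2) x (x' + unitVec ρ) (Sum.inl κ) (Sum.inl κ')
        - sandP (m + 1) (Ga (m + 1) a) (multM (m + 1) (2 * a / ((m + 1 : ℕ) : ℝ) ^ 8) 2) x x' (Sum.inl κ) (Sum.inl κ')|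
        ≤ ((((m + 1 : ℕ) : ℝ)) ^ 3)⁻¹ * K * Real.exp (-(c / ((m + 1 : ℕ) : ℝ)) * l1 (x - x')) := by
  obtain ⟨K, c, hc, hK, h⟩ := exists_sandP_ff_diff_le ha h12 h126
  refine ⟨K, c, hc, hK, fun m x x' κ κ' ρ => ⟨h m x x' κ κ' ρ, ?_⟩⟩
  have hn1 : 1 ≤ m + 1 := Nat.le_add_left 1 m
  have hGa : Spr (Ga (m + 1) a) := by
    obtain ⟨C, δ', hδ', h'⟩ := spr_Ga_of_prop12 ha h12 h126 (m + 1)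
    exact ⟨C, δ', hδ', h'⟩
  have hCmS : Spr (multM (m + 1) (2 * a / ((m + 1 : ℕ) : ℝ) ^ 8) 2) := by
    obtain ⟨C, δ', hδ', h'⟩ := spr_multM (m + 1) (2 * a / ((m + 1 : ℕ) : ℝ) ^ 8) 2
    exact ⟨C, δ', hδ', h'⟩
  haveI : NeZero (m + 1) := ⟨Nat.succ_ne_zero m⟩
  have hsym := trK_sandP (m + 1) (fun x z κ₁ m₁ => Ga_symm (m + 1) a hn1 ha x z κ₁ m₁) (multM_symm (m + 1) _ _) hGa hCmS
  -- transpose: `sandP x y (inl κ) (inl κ′) = sandP y x (inl κ′) (inl κ)`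
  have e : ∀ y : Fin 4 → ℤ, sandP (m + 1) (Ga (m + 1) a) (multM (m + 1) (2 * a / ((m + 1 : ℕ) : ℝ) ^ 8) 2) x y (Sum.inl κ) (Sum.inl κ')
      = sandP (m + 1) (Ga (m + 1) a) (multM (m + 1) (2 * a / ((m + 1 : ℕ) : ℝ) ^ 8) 2) y x (Sum.inl κ') (Sum.inl κ) := fun y => by
    conv_lhs => rw [← hsym]
    rfl
  rw [e (x' + unitVec ρ), e x', l1_sub_symm]
  exact h m x' x κ' κ ρ

end Sandwich

end Summit.QuantumFields.BalabanUV.Beta.D1BFx.RestLegSandwichGradient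

end
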